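/-
Copyright (c) 2026 the pub-hodgecm-mathlib formalisation cell (harness21).  Prover seat hodgecm-mathlib-A-p17 (g19), floor 0, programme P5
(Alb-CM), row «L4if-B2» (desk F0P5-plan (g4), 2026-08-31).  KERNEL module: THEOREMS ONLY (no definition, no named fact, no `sorry`, no
instance, no notation).
-/
import Summits.HodgeConjecture.HodgeConjecture.Theorems.F0P5CurveThetaCompanionDetTwist
import Literature.NumberTheory.GelbartRogawski1991.ChiSplittingLocalFactors
import Summits.HodgeConjecture.HodgeConjecture.Theorems.H413FinPairRepGramTransport
import Literature.NumberTheory.Automorphic.UnitaryGroupDualPairLocalLine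
import Literature.RepresentationTheory.Liu2021.OscillatorConventions
import HarnessLib

/-!
# F0 · P5 pay-down line `Cruxes/HLiu418/Lines/F0_P5_CurveThetaLettersPaydown` (ED. 7), letter L4if, brick B2 (file 1 of 2):
# the det-twist `θ ↦ θ·α̃` of the `θ`-attached splitting, read on the PLACE-ASSEMBLED Weil representations of the local
# undoublings, and the slot bookkeeping that extracts ONE local factor ([GelbartRogawski1991, §3.1 Remark p. 457]; [Liu2021, Lem. D.1 (4)])

Cell `hodgecm-mathlib`, floor 0, programme P5 (Alb-CM); crux item `stmt-HodgeConjecture-24832`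
(`Summit.HodgeConjecture.HodgeConjecture.Theses.HCCMUnconditional.HLiu418`).  Sequel of ★ `F0P5CurveThetaCompanionDetTwist` (§1, p828480:
the det-twist character `α(u) = Λ(u)⁻¹·χ(u_f)`, (T1) `Λᶜ·χ̌ = Λ·α̃`) and ★ `F0P5CurveThetaCompanionDetTwistRep` (R2G, p829048: the
companion relabel is a det-twist of the FINITE-ADELIC Weil carrier).  The pair of files (this one + `F0P5CurveThetaCompanionLocalDetTwist`)
is brick B2 of the in-house road for the last local letter L4if of #74 (memo `F0/P5/A-p18/g23/CENSUS-L4if-inhouse-road.A-p18g23.md` §1 (R-b)):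
what ★ `LocalSplitting.FinLocalSplittings.exists_twist_omegaLoc` ([GelbartRogawski1991, §3.1 Remark p. 457]: two families of local splittings give
local Weil representations `𝓢′.omegaLoc v = η_v • 𝓢.omegaLoc v` for SOME open-kernel character `η_v`) leaves open — the IDENTIFICATION of `η_v` —
is settled for the θ-packages `𝓢_θ`, `𝓢_{θ′}` (`θ′ = θ·α̃`) on ONE line: `η_v = α_v ∘ det`.  THIS FILE: the finite-adelic PAIR FORM and the
generic slot bookkeeping; the sequel: the LOCAL FORM and the CM companion `λ ↦ λᶜ·χ̌`.

MATHEMATICS, every engine ★ (a per-place PROJECTION of the global det-twist; no local uniqueness argument is needed):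
* (B) ★ `Def411WeilCarriersDoubling.chiSplittingLine_mul_ratioHecke`: `ι_{θ·α̃} = ι_θ ⊗ (α ∘ pairDet)` as compatible splittings of the
  adelic dual pair `U(diag dV)(𝔸) × U(⟨T_W⟩)(𝔸)` ([GelbartRogawski1991, §3.1 Remark p. 457 L4–13]; [HarrisKudlaSweet1996, §1 (1.14)–(1.15)]);
* (A) ★ `GRConstruction.pairSmall₁_chiSplittingLine_finPairToAdelic_eq_localRefSection`: THE `θ`-splitting read on the finite-adelic pair IS
  the reference section `localRefSection 𝓢_θ` of the local undoublings `𝓢_θ := congrW … (undoubledSplittings 𝓕)` of ANY per-place package `𝓕`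
  ([GelbartRogawski1991, §3.1 Prop. 3.1.1 p. 455 L1–3]: «the product `∏_v s_v` defines the splitting over `G(𝐀_f)`»);
* ★ `finPairRep_twist` (`ω_f^{s ⊗ ĉ} = ĉ_pair • ω_f^{s}`) and ★ `finRepMp_localRefSection_apply` (`ω_f^{s₀}(k,u) = R_e⁻¹ Ω(finPairEmb(k,u)) R_e`)
  ⇒ §1 **PAIR FORM**: `Ω_{θ′}(reindex(k ⊗ u)) = α(det((1,k) ⊗ (1,u))) • Ω_θ(reindex(k ⊗ u))` on `𝒮((𝔸_{L⁺,f})^{n′})`, `Ω = ⊗'_v ω_v` the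
  place-assembled Weil representations (★ `FinLocalSplittings.Omega`) of the big group `U(diag dV ⊗ ⟨T_W⟩)(𝔸_{L⁺,f})`;
* §2 **SLOT BOOKKEEPING** (generic `F`, `E/F`, any family `𝓣` of local splittings of a big group `U(J_V ⊗ J_W)`, `J_W` a line): the element
  `reindex(inclPlace v k ⊗ 1)` has components `k ⊗ 1` at `v` and `1` elsewhere (★ `finAdelicEquiv_finPairEmb_inl`, ★ `finAdelicEquiv_inclPlace_apply`),
  so `Ω` of it acts on a place-pure tensor `⊗_w Φ_w` (`Φ_w = 1_{𝒪_w}` off `v`) in the `v`-slot only (★ `Omega_piProdSB`); a place-pure point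
  `(t at v, 0 elsewhere)` (★ `piTranspose`) reads the `v`-slot (`finprod_eq_single`), whence ONE slot of such a pure tensor is determined, and
  `omegaLoc_localLineInl_eq_smul_of_Omega_finPairEmb_eq_smul`: a scalar relation between `Ω_{𝓣′}` and `Ω_𝓣` on `reindex(inclPlace v k ⊗ 1)`
  IS the same scalar relation between `ω′_v(k ⊗ 1)` and `ω_v(k ⊗ 1)`.

Elaboration note (numbers): on these carriers an UNTYPED `c • x` (no expected type) and a displayed `R_e⁻¹ (c • X)` cost > 1.6 M heartbeats each;
every `•` below sits under a type ascription and the assembly is an `Eq.trans` ∕ `congrArg` chain (no `rw` across the pair telescopes).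

HONEST LABEL: HC_CM is proved only modulo the printed citations — the 2 remaining named inputs (hLiu418, h413) — until rung 0 closes; this
file proves helper lemmas (brick B2 of an in-house road) toward ONE registered letter stub (L4if) of ONE floor-0 pay-down line and discharges
no letter by itself (the ε-dichotomy (D-iso)∕(D-aniso) of [HarrisKudlaSweet1996, Thm. 6.1] is NOT addressed here).

## References
* [Liu2021] Y. Liu, *Fourier–Jacobi cycles and arithmetic relative trace formula*, Camb. J. Math. 9 (2021) = arXiv:2102.11518: Def. 4.11
  (l. 2083–2097), App. D §D.1 Steps 1–3 (l. 5214–5221), Lem. D.1 (4) (p. 126, l. 5235).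
* [GelbartRogawski1991] S. Gelbart, J. Rogawski, *L-functions and Fourier–Jacobi coefficients for the unitary group U(3)*, Invent. Math. 105
  (1991), §3.1 Prop. 3.1.1 p. 455 L1–3, Remark p. 457 L4–13, §3.2 p. 457.
* [HarrisKudlaSweet1996] M. Harris, S. Kudla, W. J. Sweet, *Theta dichotomy for unitary groups*, J. AMS 9 (1996), §1 (1.14)–(1.15).
* [Weil1964] A. Weil, *Sur certains groupes d'opérateurs unitaires*, Acta Math. 111 (1964), Chap. III n° 37–38 pp. 188–190.
-/

set_option autoImplicit false
set_option linter.dupNamespace false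

noncomputable section

open NumberField NumberField.InfinitePlace NumberField.mixedEmbedding IsDedekindDomain
open scoped Matrix Kronecker ComplexOrder RestrictedProduct Classical
open Literature.NumberTheory.Automorphic Literature.NumberTheory.Automorphic.UnitaryGroup
open Literature.NumberTheory.Automorphic.Liu2021 Literature.NumberTheory.Automorphic.Liu2021.Def411WeilCarriers
open Literature.NumberTheory.Automorphic.Liu2021.Def411WeilCarriersDoubling
open Literature.NumberTheory.GaloisRepresentations Literature.NumberTheory.Automorphic.IdeleClassGroup
open Literature.NumberTheory.GelbartRogawski1991 Literature.NumberTheory.GelbartRogawski1991.UnitaryDualPair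
open Literature.NumberTheory.GelbartRogawski1991.UnitaryDualPair.WeilCoinv
open Literature.NumberTheory.GelbartRogawski1991.UnitaryDualPair.LocalSplitting
open Literature.NumberTheory.GelbartRogawski1991.GRConstruction
open Literature.NumberTheory.GelbartRogawski1991.GRConstruction.DoubledWeilDetTwist
open Literature.NumberTheory.Weil1964
open Literature.RepresentationTheory (SeesawScalar.twist SeesawScalar.twist_apply)
open Literature.RepresentationTheory.Liu2021 Literature.RepresentationTheory.HarrisKudlaSweet1996

namespace Summit.HodgeConjecture.HodgeConjecture.Cruxes.HLiu418.F0P5CurveThetaCompanionDetTwist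

/-! ## §0 A `subst` lemma: the finite Weil representations `finRepMp` along EQUAL sections coincide (the `finPairRep` form is ★
`H413.ThetaJunction.finPairRep_congr_splitting`) -/

section Congr

/-- `finRepMp hT s₁ _ = finRepMp hT s₂ _` for `s₁ = s₂` (the archimedean-clause argument is a proof). [folklore] -/
private theorem finRepMp_congr_section {F : Type} [Field F] [NumberField F] {ι : Type} [Fintype ι] [DecidableEq ι]
    {T : Matrix ι ι (AdeleRing (𝓞 F) F)} (hT : IsUnit T) {H : Type*} [Monoid H] {s₁ s₂ : H →* adelicMpCont F ι T}
    (h : s₁ = s₂)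
    (h₁ : ∀ (x : H) (a w : ι → mixedSpace F),
      (adelicMpCont.proj F ι T (s₁ x)).1 (archVec F ι a, archVec F ι w) = (archVec F ι a, archVec F ι w))
    (h₂ : ∀ (x : H) (a w : ι → mixedSpace F),
      (adelicMpCont.proj F ι T (s₂ x)).1 (archVec F ι a, archVec F ι w) = (archVec F ι a, archVec F ι w)) :
    finRepMp hT s₁ h₁ = finRepMp hT s₂ h₂ := by
  subst h
  rfl

end Congr

/-! ## §1 PAIR FORM: the place-assembled Weil representations of the packages of `θ` and `θ′ = θ·α̃` on one line differ by `α ∘ det`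
on the finite-adelic dual pair -/

section Pair

variable (L : Type) [Field L] [NumberField L] [IsCMField L]
variable {N' n' : ℕ} (e₁ : Fin N' × Fin 1 ≃ Fin n')
  (dV₁ : Fin N' → L) (hdV₁ : ∀ i, IsCMField.complexConj L (dV₁ i) = dV₁ i) (hdV₁0 : ∀ i, dV₁ i ≠ 0)
  (θ : HeckeCharacter L) (hθu : θ.IsUnitary) (hθs : IsSplittingChar L 1 θ)
  {α : UnitaryGroup.adelicOne (Fp L) L (IsCMField.complexConj L) →* ℂˣ} (hc : Continuous α)
  (hrat : ∀ u : UnitaryGroup.adelicOne (Fp L) L (IsCMField.complexConj L), (u : ideleGroup L) ∈ principalIdeles L → α u = 1)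
  (hαu : ∀ u, ‖((α u : ℂˣ) : ℂ)‖ = 1)
  (θ' : HeckeCharacter L) (hθ'u : θ'.IsUnitary) (hθ's : IsSplittingChar L 1 θ')
  (TW : Matrix (Fin 1) (Fin 1) (Fp L)) (hW : TW.IsSymm) (hWd : IsUnit TW.det) (JW : Matrix (Fin 1) (Fin 1) L)
  (hJW : JW = TW.map (algebraMap (Fp L) L))
  (𝔪 𝔪' : ∀ v, PlaceMeasure L v)
  (𝓕 : FinLocalFamily L e₁ dV₁ hdV₁ hdV₁0 (lineW L TW) (complexConj_lineW L TW) (lineW_ne_zero L TW hWd) θ 𝔪)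
  (𝓕' : FinLocalFamily L e₁ dV₁ hdV₁ hdV₁0 (lineW L TW) (complexConj_lineW L TW) (lineW_ne_zero L TW hWd) θ' 𝔪')

include hθu hθs hαu hθ'u hθ's in
set_option maxHeartbeats 3200000 in
-- measured (800 k, 1.6 M] on the check farm; 3.2 M = 2× head-room for the BUILD lane (edition 1 at 1.6 M was BUILD-RED on
-- lean-root-8, ops-buildfix B38-N15, while every `lean check` passed): one pass through the pair-splitting ∕ `localRefSection` telescopes (as ★ `exists_equiv_rhoVAtLine_chiSplittingLine_omega_finPairEmb`)
/-- **PAIR FORM — `Ω_{θ′}(reindex(k ⊗ u)) = α(det((1,k) ⊗ (1,u))) • Ω_θ(reindex(k ⊗ u))`.**  For unitary Hecke characters `θ`, `θ′ = θ·α̃`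
with `θ|_{𝕀_{L⁺}} = ε` (`α̃ = ratioHecke L α`, `α` a continuous unitary automorphic character of `U(1)(𝔸_{L⁺})`) and ANY per-place packages
`𝓕`, `𝓕′` of the doubled CM datum at the line `⟨T_W⟩` (any Haar data), the place-assembled Weil representations `Ω = ⊗'_v ω_v` of the local
undoublings `𝓢_θ := congrW … (undoubledSplittings 𝓕)`, `𝓢_{θ′} := congrW … (undoubledSplittings 𝓕′)` of the big group `U(diag dV ⊗ J_W)(𝔸_{L⁺,f})`
satisfy, on the finite-adelic dual pair `(k, u)`:  `𝓢_{θ′}.Omega (finPairEmb (k,u)) X = α(pairDet((1,k)·(1,u))) • 𝓢_θ.Omega (finPairEmb (k,u)) X`.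
Proof: (B) ★ `chiSplittingLine_mul_ratioHecke` + (A) ★ `pairSmall₁_chiSplittingLine_finPairToAdelic_eq_localRefSection` (for `θ` AND `θ′`) +
★ `finPairRep_twist` + ★ `finRepMp_localRefSection_apply`.
[cite: GelbartRogawski1991, §3.1 Prop. 3.1.1 p. 455 L1–3, Remark p. 457 L4–13] [cite: HarrisKudlaSweet1996, §1 (1.14)–(1.15)]
[cite: Liu2021, App. D §D.1 Step 2 (l. 5219), Lem. D.1 (4) (p. 126)] -/
theorem Omega_finPairEmb_eq_detTwist_smul_of_mul_ratioHecke (hΛ : θ' = θ * ratioHecke L α hc hrat)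
    (q : UnitaryGroup.finAdelic (Fp L) L (IsCMField.complexConj L) N' (Matrix.diagonal dV₁) ×
      UnitaryGroup.finAdelic (Fp L) L (IsCMField.complexConj L) 1 JW)
    (X : FinSB (Fp L) (Fin n')) :
    (congrW L e₁ dV₁ hdV₁ (lineW L TW) (complexConj_lineW L TW) (realDiagonal_lineW L TW) (diagonal_lineW L TW hJW)
        (undoubledSplittings L e₁ dV₁ hdV₁ hdV₁0 (lineW L TW) (complexConj_lineW L TW) (lineW_ne_zero L TW hWd) θ' 𝔪' 𝓕')
        hW hJW).Omega
        (finPairEmb (Fp L) L (IsCMField.complexConj L) N' 1 e₁ (Matrix.diagonal dV₁) JW q) X =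
      ((α (pairDet (Fp L) L (IsCMField.complexConj L) N' 1 e₁ (Matrix.diagonal dV₁) JW
            (det_reindex_kronecker_diagonal_line_ne_zero L e₁ dV₁ hdV₁0 TW hWd JW hJW)
            (UnitaryGroup.adelicInl (Fp L) L (IsCMField.complexConj L) N' 1 (Matrix.diagonal dV₁) JW
                (UnitaryGroup.finAdelicToAdelic (Fp L) L (IsCMField.complexConj L) N' (Matrix.diagonal dV₁) q.1) *
              UnitaryGroup.adelicInr (Fp L) L (IsCMField.complexConj L) N' 1 (Matrix.diagonal dV₁) JW
                (UnitaryGroup.finAdelicToAdelic (Fp L) L (IsCMField.complexConj L) 1 JW q.2))) : ℂˣ) : ℂ) •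
        (congrW L e₁ dV₁ hdV₁ (lineW L TW) (complexConj_lineW L TW) (realDiagonal_lineW L TW) (diagonal_lineW L TW hJW)
          (undoubledSplittings L e₁ dV₁ hdV₁ hdV₁0 (lineW L TW) (complexConj_lineW L TW) (lineW_ne_zero L TW hWd) θ 𝔪 𝓕)
          hW hJW).Omega
          (finPairEmb (Fp L) L (IsCMField.complexConj L) N' 1 e₁ (Matrix.diagonal dV₁) JW q) X := by
  subst hΛ
  -- abbreviations
  set 𝓢 := congrW L e₁ dV₁ hdV₁ (lineW L TW) (complexConj_lineW L TW) (realDiagonal_lineW L TW) (diagonal_lineW L TW hJW)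
      (undoubledSplittings L e₁ dV₁ hdV₁ hdV₁0 (lineW L TW) (complexConj_lineW L TW) (lineW_ne_zero L TW hWd) θ 𝔪 𝓕) hW hJW
    with h𝓢
  set 𝓢' := congrW L e₁ dV₁ hdV₁ (lineW L TW) (complexConj_lineW L TW) (realDiagonal_lineW L TW) (diagonal_lineW L TW hJW)
      (undoubledSplittings L e₁ dV₁ hdV₁ hdV₁0 (lineW L TW) (complexConj_lineW L TW) (lineW_ne_zero L TW hWd)
        (θ * ratioHecke L α hc hrat) 𝔪' 𝓕') hW hJW with h𝓢'
  set η : UnitaryGroup.adelicPair (Fp L) L (IsCMField.complexConj L) N' 1 (Matrix.diagonal dV₁) JW →* ℂˣ :=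
    α.comp (pairDet (Fp L) L (IsCMField.complexConj L) N' 1 e₁ (Matrix.diagonal dV₁) JW
      (det_reindex_kronecker_diagonal_line_ne_zero L e₁ dV₁ hdV₁0 TW hWd JW hJW)) with hη
  -- the two compatible pair splittings and (B) the det-twist identity between them
  have hs := isCompatible_chiSplittingLine L e₁ dV₁ hdV₁ hdV₁0 θ hθu hθs TW hW hWd JW hJW
  have hs' := isCompatible_chiSplittingLine L e₁ dV₁ hdV₁ hdV₁0 (θ * ratioHecke L α hc hrat) hθ'u hθ's TW hW hWd JW hJW
  have hs_eq : chiSplittingLine L e₁ dV₁ hdV₁ hdV₁0 (θ * ratioHecke L α hc hrat) hθ'u hθ's TW hWd JW hJW =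
      adelicMpCont.twist (Fp L) (Fin n') (adelicGram (Fp L) e₁ (realDiagonal L dV₁ hdV₁) TW)
        (chiSplittingLine L e₁ dV₁ hdV₁ hdV₁0 θ hθu hθs TW hWd JW hJW) η :=
    chiSplittingLine_mul_ratioHecke L e₁ dV₁ hdV₁ hdV₁0 θ hθu hθs hc hrat hαu TW hWd JW hJW
  have hs₂ : (splittingDatum (Fp L) L (IsCMField.complexConj L) N' 1 e₁ (Matrix.diagonal dV₁) JW (complexConj_imagUnit L)
      (imagUnit_ne_zero L) (imagUnit_mul_self L) (realDiagonal_isSymm L dV₁ hdV₁) hW (isUnit_det_realDiagonal L dV₁ hdV₁ hdV₁0) hWd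
      (realDiagonal_map L dV₁ hdV₁).symm hJW).IsCompatible
      (adelicMpCont.twist (Fp L) (Fin n') (adelicGram (Fp L) e₁ (realDiagonal L dV₁ hdV₁) TW)
        (chiSplittingLine L e₁ dV₁ hdV₁ hdV₁0 θ hθu hθs TW hWd JW hJW) η) := hs_eq ▸ hs'
  -- (A) for `θ` and for `θ′`: the pair sections ARE the reference sections of the local undoublings
  have hA : (pairSmall₁ (Fp L) L (IsCMField.complexConj L) N' 1 e₁ (Matrix.diagonal dV₁) JW
        (chiSplittingLine L e₁ dV₁ hdV₁ hdV₁0 θ hθu hθs TW hWd JW hJW)).comp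
      (finPairToAdelic (Fp L) L (IsCMField.complexConj L) N' 1 (Matrix.diagonal dV₁) JW) =
      localRefSection (Fp L) L (IsCMField.complexConj L) N' 1 e₁ (Matrix.diagonal dV₁) JW (complexConj_imagUnit L) (imagUnit_ne_zero L)
        (imagUnit_mul_self L) (realDiagonal_isSymm L dV₁ hdV₁) hW (realDiagonal_map L dV₁ hdV₁).symm hJW 𝓢 := by
    rw [h𝓢]
    exact pairSmall₁_chiSplittingLine_finPairToAdelic_eq_localRefSection L θ hθu hθs e₁ dV₁ hdV₁ hdV₁0 TW hW hWd JW hJW 𝔪 𝓕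
  have hA' : (pairSmall₁ (Fp L) L (IsCMField.complexConj L) N' 1 e₁ (Matrix.diagonal dV₁) JW
        (chiSplittingLine L e₁ dV₁ hdV₁ hdV₁0 (θ * ratioHecke L α hc hrat) hθ'u hθ's TW hWd JW hJW)).comp
      (finPairToAdelic (Fp L) L (IsCMField.complexConj L) N' 1 (Matrix.diagonal dV₁) JW) =
      localRefSection (Fp L) L (IsCMField.complexConj L) N' 1 e₁ (Matrix.diagonal dV₁) JW (complexConj_imagUnit L) (imagUnit_ne_zero L)
        (imagUnit_mul_self L) (realDiagonal_isSymm L dV₁ hdV₁) hW (realDiagonal_map L dV₁ hdV₁).symm hJW 𝓢' := by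
    rw [h𝓢']
    exact pairSmall₁_chiSplittingLine_finPairToAdelic_eq_localRefSection L (θ * ratioHecke L α hc hrat) hθ'u hθ's e₁ dV₁ hdV₁ hdV₁0
      TW hW hWd JW hJW 𝔪' 𝓕'
  -- the finite Weil representations of the pair, read on the place-assembled side
  set f : FinSB (Fp L) (Fin N' × Fin 1) := (finSBReindex (Fp L) e₁).symm X with hf
  have hX : finSBReindex (Fp L) e₁ f = X := by rw [hf, LinearEquiv.apply_symm_apply]
  have h3 : finPairRep (Fp L) L (IsCMField.complexConj L) N' 1 e₁ (Matrix.diagonal dV₁) JW (complexConj_imagUnit L) (imagUnit_ne_zero L)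
        (imagUnit_mul_self L) (realDiagonal_isSymm L dV₁ hdV₁) hW (isUnit_det_realDiagonal L dV₁ hdV₁ hdV₁0) hWd
        (realDiagonal_map L dV₁ hdV₁).symm hJW hs q f =
      (finSBReindex (Fp L) e₁).symm (𝓢.Omega (finPairEmb (Fp L) L (IsCMField.complexConj L) N' 1 e₁ (Matrix.diagonal dV₁) JW q) X) := by
    rw [← hX, ← finRepMp_localRefSection_apply (Fp L) L (IsCMField.complexConj L) N' 1 e₁ (Matrix.diagonal dV₁) JW (complexConj_imagUnit L)
      (imagUnit_ne_zero L) (imagUnit_mul_self L) (realDiagonal_isSymm L dV₁ hdV₁) hW (isUnit_det_realDiagonal L dV₁ hdV₁ hdV₁0) hWd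
      (realDiagonal_map L dV₁ hdV₁).symm hJW 𝓢 hs q f]
    exact congrArg (fun ρ : Representation ℂ _ (FinSB (Fp L) (Fin N' × Fin 1)) => ρ q f)
      (finRepMp_congr_section (isUnit_kronecker_map (Fp L) N' (isUnit_det_realDiagonal L dV₁ hdV₁ hdV₁0) hWd) hA _ _)
  have h3' : finPairRep (Fp L) L (IsCMField.complexConj L) N' 1 e₁ (Matrix.diagonal dV₁) JW (complexConj_imagUnit L) (imagUnit_ne_zero L)
        (imagUnit_mul_self L) (realDiagonal_isSymm L dV₁ hdV₁) hW (isUnit_det_realDiagonal L dV₁ hdV₁ hdV₁0) hWd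
        (realDiagonal_map L dV₁ hdV₁).symm hJW hs' q f =
      (finSBReindex (Fp L) e₁).symm (𝓢'.Omega (finPairEmb (Fp L) L (IsCMField.complexConj L) N' 1 e₁ (Matrix.diagonal dV₁) JW q) X) := by
    rw [← hX, ← finRepMp_localRefSection_apply (Fp L) L (IsCMField.complexConj L) N' 1 e₁ (Matrix.diagonal dV₁) JW (complexConj_imagUnit L)
      (imagUnit_ne_zero L) (imagUnit_mul_self L) (realDiagonal_isSymm L dV₁ hdV₁) hW (isUnit_det_realDiagonal L dV₁ hdV₁ hdV₁0) hWd
      (realDiagonal_map L dV₁ hdV₁).symm hJW 𝓢' hs' q f]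
    exact congrArg (fun ρ : Representation ℂ _ (FinSB (Fp L) (Fin N' × Fin 1)) => ρ q f)
      (finRepMp_congr_section (isUnit_kronecker_map (Fp L) N' (isUnit_det_realDiagonal L dV₁ hdV₁ hdV₁0) hWd) hA' _ _)
  -- ★ `finPairRep_twist` along (B), transported through ★ `finPairRep_congr_splitting`
  have h12 : finPairRep (Fp L) L (IsCMField.complexConj L) N' 1 e₁ (Matrix.diagonal dV₁) JW (complexConj_imagUnit L) (imagUnit_ne_zero L)
        (imagUnit_mul_self L) (realDiagonal_isSymm L dV₁ hdV₁) hW (isUnit_det_realDiagonal L dV₁ hdV₁ hdV₁0) hWd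
        (realDiagonal_map L dV₁ hdV₁).symm hJW hs' q f =
      ((twistCharV (Fp L) L (IsCMField.complexConj L) N' 1 (Matrix.diagonal dV₁) JW η q.1 *
          twistCharW (Fp L) L (IsCMField.complexConj L) N' 1 (Matrix.diagonal dV₁) JW η q.2 : ℂˣ) : ℂ) •
        finPairRep (Fp L) L (IsCMField.complexConj L) N' 1 e₁ (Matrix.diagonal dV₁) JW (complexConj_imagUnit L) (imagUnit_ne_zero L)
          (imagUnit_mul_self L) (realDiagonal_isSymm L dV₁ hdV₁) hW (isUnit_det_realDiagonal L dV₁ hdV₁ hdV₁0) hWd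
          (realDiagonal_map L dV₁ hdV₁).symm hJW hs q f := by
    rw [congrArg (fun ρ : Representation ℂ _ (FinSB (Fp L) (Fin N' × Fin 1)) => ρ q f)
      (Summit.HodgeConjecture.HodgeConjecture.Cruxes.H413.ThetaJunction.finPairRep_congr_splitting (Fp L) L (IsCMField.complexConj L) N' 1 e₁
        (Matrix.diagonal dV₁) JW (complexConj_imagUnit L)
        (imagUnit_ne_zero L) (imagUnit_mul_self L) (realDiagonal_isSymm L dV₁ hdV₁) hW (isUnit_det_realDiagonal L dV₁ hdV₁ hdV₁0) hWd
        (realDiagonal_map L dV₁ hdV₁).symm hJW hs_eq hs' hs₂)]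
    exact finPairRep_twist (Fp L) L (IsCMField.complexConj L) N' 1 e₁ (Matrix.diagonal dV₁) JW (complexConj_imagUnit L) (imagUnit_ne_zero L)
      (imagUnit_mul_self L) (realDiagonal_isSymm L dV₁ hdV₁) hW (isUnit_det_realDiagonal L dV₁ hdV₁ hdV₁0) hWd
      (realDiagonal_map L dV₁ hdV₁).symm hJW η hs hs₂ q f
  -- assemble (term mode — no `rw` across the telescopes): strip `R_e⁻¹`, then read the coefficient
  have hcoef : twistCharV (Fp L) L (IsCMField.complexConj L) N' 1 (Matrix.diagonal dV₁) JW η q.1 *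
        twistCharW (Fp L) L (IsCMField.complexConj L) N' 1 (Matrix.diagonal dV₁) JW η q.2 =
      α (pairDet (Fp L) L (IsCMField.complexConj L) N' 1 e₁ (Matrix.diagonal dV₁) JW
        (det_reindex_kronecker_diagonal_line_ne_zero L e₁ dV₁ hdV₁0 TW hWd JW hJW)
        (UnitaryGroup.adelicInl (Fp L) L (IsCMField.complexConj L) N' 1 (Matrix.diagonal dV₁) JW
            (UnitaryGroup.finAdelicToAdelic (Fp L) L (IsCMField.complexConj L) N' (Matrix.diagonal dV₁) q.1) *
          UnitaryGroup.adelicInr (Fp L) L (IsCMField.complexConj L) N' 1 (Matrix.diagonal dV₁) JW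
            (UnitaryGroup.finAdelicToAdelic (Fp L) L (IsCMField.complexConj L) 1 JW q.2))) :=
    (map_mul η (UnitaryGroup.adelicInl (Fp L) L (IsCMField.complexConj L) N' 1 (Matrix.diagonal dV₁) JW
        (UnitaryGroup.finAdelicToAdelic (Fp L) L (IsCMField.complexConj L) N' (Matrix.diagonal dV₁) q.1))
      (UnitaryGroup.adelicInr (Fp L) L (IsCMField.complexConj L) N' 1 (Matrix.diagonal dV₁) JW
        (UnitaryGroup.finAdelicToAdelic (Fp L) L (IsCMField.complexConj L) 1 JW q.2))).symm
  -- (no ascribed intermediate statements and every `•` under a type ascription: the untyped `•` elaborator ∕ the coercion of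
  --  `R_e⁻¹` to a function make a displayed `R_e⁻¹ (c • Ω X)` prohibitively slow to elaborate on these carriers)
  have t1 := congrArg (fun y : FinSB (Fp L) (Fin N' × Fin 1) => (((twistCharV (Fp L) L (IsCMField.complexConj L) N' 1 (Matrix.diagonal dV₁) JW η q.1 *
            twistCharW (Fp L) L (IsCMField.complexConj L) N' 1 (Matrix.diagonal dV₁) JW η q.2 : ℂˣ) : ℂ) • y : FinSB (Fp L) (Fin N' × Fin 1))) h3
  have t3 := (finSBReindex (Fp L) e₁).symm.map_smul ((twistCharV (Fp L) L (IsCMField.complexConj L) N' 1 (Matrix.diagonal dV₁) JW η q.1 *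
            twistCharW (Fp L) L (IsCMField.complexConj L) N' 1 (Matrix.diagonal dV₁) JW η q.2 : ℂˣ) : ℂ) (𝓢.Omega (finPairEmb (Fp L) L (IsCMField.complexConj L) N' 1 e₁ (Matrix.diagonal dV₁) JW q) X)
  have key := h3'.symm.trans ((h12.trans t1).trans t3.symm)
  exact ((finSBReindex (Fp L) e₁).symm.injective key).trans (congrArg (fun u : ℂˣ => (((u : ℂ) •
    𝓢.Omega (finPairEmb (Fp L) L (IsCMField.complexConj L) N' 1 e₁ (Matrix.diagonal dV₁) JW q) X) : FinSB (Fp L) (Fin n'))) hcoef)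

end Pair

/-! ## §2 Generic slot bookkeeping: the big-group element `reindex(inclPlace v k ⊗ 1)` on place-pure tensors, and
reading one slot of a pure tensor at a place-pure point -/

section SlotPoint

variable (F : Type) [Field F] [NumberField F]

/-- **place-pure points read the `v`-slot of a pure tensor**: for `t ∈ (F_v)^ι` there is `x ∈ (𝔸_{F,f})^ι` (`t` at `v`, `0` elsewhere) with
`(⊗_w Φ_w)(x) = Φ_v(t)` whenever `Φ_w = 1_{𝒪_w}` off `v`. [cite: Weil1964, Chap. III n° 37–38 pp. 188–190] -/
theorem exists_piProdSB_update_apply_eq (ι : Type) [Finite ι] (v : HeightOneSpectrum (𝓞 F)) (t : ι → v.adicCompletion F) :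
    ∃ x : ι → FiniteAdeleRing (𝓞 F) F, ∀ Ψ : SchwartzBruhat (ι → v.adicCompletion F),
      ((piProdSB F ι ((RestrictedFamily.base fun w => unitVec F ι w).update v Ψ) : SchwartzBruhat (ι → FiniteAdeleRing (𝓞 F) F)) :
          (ι → FiniteAdeleRing (𝓞 F) F) → ℂ) x =
        (Ψ : (ι → v.adicCompletion F) → ℂ) t := by
  have hy : ∀ᶠ w in Filter.cofinite, Function.update (fun w : HeightOneSpectrum (𝓞 F) => (0 : ι → w.adicCompletion F)) v t w ∈
      integralBox F ι w :=
    (Filter.eventually_cofinite_ne v).mono fun w hw =>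
      Set.mem_of_eq_of_mem (Function.update_of_ne hw t (fun w : HeightOneSpectrum (𝓞 F) => (0 : ι → w.adicCompletion F)))
        (zero_mem_integralBox F ι w)
  let y : Πʳ w : HeightOneSpectrum (𝓞 F), [ι → w.adicCompletion F, integralBox F ι w] := ⟨_, hy⟩
  refine ⟨(piTranspose F ι).symm y, fun Ψ => ?_⟩
  rw [coe_piProdSB, piProd_eq_finprod_piTranspose, Equiv.apply_symm_apply]
  rw [finprod_eq_single (fun w => (((RestrictedFamily.base fun w => unitVec F ι w).update v Ψ) w :
    (ι → w.adicCompletion F) → ℂ) (y w)) v]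
  · change ((Function.update (⇑(RestrictedFamily.base fun w => unitVec F ι w)) v Ψ v : SchwartzBruhat (ι → v.adicCompletion F)) :
        (ι → v.adicCompletion F) → ℂ) (Function.update (fun w : HeightOneSpectrum (𝓞 F) => (0 : ι → w.adicCompletion F)) v t v) = _
    rw [Function.update_self, Function.update_self]
  · intro w hw
    change ((Function.update (⇑(RestrictedFamily.base fun w => unitVec F ι w)) v Ψ w : SchwartzBruhat (ι → w.adicCompletion F)) :
        (ι → w.adicCompletion F) → ℂ) (Function.update (fun w : HeightOneSpectrum (𝓞 F) => (0 : ι → w.adicCompletion F)) v t w) = 1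
    rw [Function.update_of_ne hw, Function.update_of_ne hw, RestrictedFamily.base_apply]
    exact unitVec_apply_of_mem (zero_mem_integralBox F ι w)

/-- **one slot of a pure tensor is determined**: `⊗_w Φ′_w = a • ⊗_w Φ″_w` with `Φ′_w = Φ″_w = 1_{𝒪_w}` off `v` forces `Φ′_v = a • Φ″_v`
(evaluate at the place-pure points). [cite: Weil1964, Chap. III n° 37–38 pp. 188–190] -/
theorem eq_smul_of_piProdSB_update_eq_smul (ι : Type) [Finite ι] (v : HeightOneSpectrum (𝓞 F))
    {Ψ₁ Ψ₂ : SchwartzBruhat (ι → v.adicCompletion F)} {a : ℂ}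
    (h : piProdSB F ι ((RestrictedFamily.base fun w => unitVec F ι w).update v Ψ₁) =
      a • piProdSB F ι ((RestrictedFamily.base fun w => unitVec F ι w).update v Ψ₂)) : Ψ₁ = a • Ψ₂ := by
  refine Subtype.ext (funext fun t => ?_)
  obtain ⟨x, hx⟩ := exists_piProdSB_update_apply_eq F ι v t
  have h' := congrArg (fun Φ' : SchwartzBruhat (ι → FiniteAdeleRing (𝓞 F) F) => (Φ' : (ι → FiniteAdeleRing (𝓞 F) F) → ℂ) x) h
  rw [hx, Submodule.coe_smul, Pi.smul_apply, hx, smul_eq_mul] at h'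
  rw [h', Submodule.coe_smul, Pi.smul_apply, smul_eq_mul]

end SlotPoint

section Slot

variable (F E : Type) [Field F] [NumberField F] [Field E] [NumberField E] [Algebra F E]
variable (c : E ≃ₐ[F] E) (N : ℕ) {n : ℕ} (e : Fin N × Fin 1 ≃ Fin n)
variable (JV : Matrix (Fin N) (Fin N) E) (JW : Matrix (Fin 1) (Fin 1) E)
variable {TV : Matrix (Fin N) (Fin N) F} {TW : Matrix (Fin 1) (Fin 1) F}
variable [Algebra.IsQuadraticExtension F E] {δ : E} (hcδ : c δ = -δ) (hδ : δ ≠ 0) {d : F}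
  (hd : δ * δ = algebraMap F E d) (hV : TV.IsSymm) (hW : TW.IsSymm)
  (hJV : JV = TV.map (algebraMap F E)) (hJW : JW = TW.map (algebraMap F E))

omit [Algebra.IsQuadraticExtension F E] in
/-- **the big-group element `reindex(inclPlace v k ⊗ 1)` has `w`-component `(mulSingle v k)_w ⊗ 1`**: `k ⊗ 1` at `w = v`, trivial elsewhere.
[cite: GelbartRogawski1991, §3.2 p. 457] -/
theorem evalPlace_finPairEmb_inclPlace_one (v w : HeightOneSpectrum (𝓞 F)) (k : UnitaryGroup.localPi E c N JV v) :
    UnitaryGroup.evalPlace F E c n (Matrix.reindex e e (JV ⊗ₖ JW)) w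
        (finPairEmb F E c N 1 e JV JW (UnitaryGroup.inclPlace F E c N JV v k, 1)) =
      UnitaryGroup.localLineInl E c N e JV JW w
        (Pi.mulSingle (M := fun w : HeightOneSpectrum (𝓞 F) => ↥(UnitaryGroup.localPi E c N JV w)) v k w) := by
  change UnitaryGroup.finAdelicEquiv F E c n (Matrix.reindex e e (JV ⊗ₖ JW)) _ w = _
  rw [UnitaryGroup.finAdelicEquiv_finPairEmb_inl, UnitaryGroup.finAdelicEquiv_inclPlace_apply]

/-- **`Ω(reindex(inclPlace v k ⊗ 1))` on a place-pure tensor acts in the `v`-slot only**: for ANY family `𝓣` of local splittings of the big group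
`U(J_V ⊗ J_W)`, `Ω (⊗_w Φ_w) = ⊗_w Φ′_w` with `Φ′_v = ω_v(k ⊗ 1) Φ_v` and `Φ′_w = Φ_w = 1_{𝒪_w}` for `w ≠ v` (★ `Omega_piProdSB` slot by slot).
[cite: Weil1964, Chap. III n° 37–38 pp. 188–190] [cite: GelbartRogawski1991, §3.1 Prop. 3.1.1 p. 455 L1–3] -/
theorem Omega_finPairEmb_inclPlace_piProdSB_update
    (𝓣 : FinLocalSplittings F E c n hcδ hδ hd (gram F e TV TW) (isSymm_gram F e hV hW) (reindex_kronecker_eq_gram_map F E e hJV hJW))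
    (v : HeightOneSpectrum (𝓞 F)) (k : UnitaryGroup.localPi E c N JV v) (Φ : SchwartzBruhat (Fin n → v.adicCompletion F)) :
    𝓣.Omega (finPairEmb F E c N 1 e JV JW (UnitaryGroup.inclPlace F E c N JV v k, 1))
        (piProdSB F (Fin n) ((RestrictedFamily.base fun w => unitVec F (Fin n) w).update v Φ)) =
      piProdSB F (Fin n) ((RestrictedFamily.base fun w => unitVec F (Fin n) w).update v
        (𝓣.omegaLoc v (UnitaryGroup.localLineInl E c N e JV JW v k) Φ)) := by
  refine (𝓣.Omega_piProdSB _ _).trans (congrArg (piProdSB F (Fin n)) (RestrictedProduct.ext _ _ fun w => ?_))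
  rw [FinLocalSplittings.smul_apply, RestrictedFamily.update_apply, RestrictedFamily.update_apply,
    evalPlace_finPairEmb_inclPlace_one F E c N e JV JW v w k]
  by_cases hw : w = v
  · subst hw
    rw [Function.update_self, Function.update_self, Pi.mulSingle_eq_same]
  · rw [Function.update_of_ne hw, Function.update_of_ne hw, Pi.mulSingle_eq_of_ne hw, map_one, map_one, Module.End.one_apply]

/-- **from the pair to the place**: if the place-assembled Weil representations of TWO families `𝓣`, `𝓣′` of local splittings of the big group
differ on `reindex(inclPlace v k ⊗ 1)` by the scalar `c₀ = c₁`, then the LOCAL Weil representations at `v` differ on `k ⊗ 1` by `c₁`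
(`Omega_finPairEmb_inclPlace_piProdSB_update` on both sides + `eq_smul_of_piProdSB_update_eq_smul`).
[cite: Weil1964, Chap. III n° 37–38 pp. 188–190] [cite: GelbartRogawski1991, §3.1 Prop. 3.1.1 p. 455 L1–3, Remark p. 457 L4–13] -/
theorem omegaLoc_localLineInl_eq_smul_of_Omega_finPairEmb_eq_smul
    (𝓣 𝓣' : FinLocalSplittings F E c n hcδ hδ hd (gram F e TV TW) (isSymm_gram F e hV hW) (reindex_kronecker_eq_gram_map F E e hJV hJW))
    (v : HeightOneSpectrum (𝓞 F)) (k : UnitaryGroup.localPi E c N JV v) {c₀ c₁ : ℂ} (hc : c₀ = c₁)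
    (h : ∀ X : FinSB F (Fin n),
      𝓣'.Omega (finPairEmb F E c N 1 e JV JW (UnitaryGroup.inclPlace F E c N JV v k, 1)) X =
        c₀ • 𝓣.Omega (finPairEmb F E c N 1 e JV JW (UnitaryGroup.inclPlace F E c N JV v k, 1)) X)
    (Φ : SchwartzBruhat (Fin n → v.adicCompletion F)) :
    𝓣'.omegaLoc v (UnitaryGroup.localLineInl E c N e JV JW v k) Φ =
      c₁ • 𝓣.omegaLoc v (UnitaryGroup.localLineInl E c N e JV JW v k) Φ := by
  subst hc
  refine eq_smul_of_piProdSB_update_eq_smul F (Fin n) v ?_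
  exact (Omega_finPairEmb_inclPlace_piProdSB_update F E c N e JV JW hcδ hδ hd hV hW hJV hJW 𝓣' v k Φ).symm.trans
    ((h _).trans (congrArg (fun y : FinSB F (Fin n) => (c₀ • y : FinSB F (Fin n)))
      (Omega_finPairEmb_inclPlace_piProdSB_update F E c N e JV JW hcδ hδ hd hV hW hJV hJW 𝓣 v k Φ)))

end Slot

end Summit.HodgeConjecture.HodgeConjecture.Cruxes.HLiu418.F0P5CurveThetaCompanionDetTwist

end
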